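import Summits.Parity.GeneralizedHardyLittlewood.Theorems.LeeYangFibresRelativeDimOneTypeDefs
import Summits.Parity.GeneralizedHardyLittlewood.Theorems.LeeYangFibresCellParityLawSingularRatio
import Literature.NumberTheory.Sieve.LinearEquationsInPrimesLocalObstruction
import HarnessLib

/-!
# Route `LeeYangFibres`, crux `RelativeDimOne` (stmt-Parity-14113), line `gallagher-backwards-split` (RESHAPED,
# type-conditioned split): singular-weight fact (W1) for the stub `stub_singularWeights`

(W1) THE SMOOTH SCALE IS DOMINATED BY THE SINGULAR SERIES: for every `t ≥ 1` there is `C_t` with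
`G_w(a, b) = ∏_{p ≤ w} (1 + |β_p − 1| + t²/p²) ≤ C_t · 𝔖(a, b)` for all `w` and all non-degenerate `d = 1` systems
`(a_i n + b_i)_i` with `𝔖 ≠ 0` — uniformly in the coefficients (no size bound is needed).

Proof (bookkeeping with Green–Tao's local factors `β_p = p⁻¹ (p/(p−1))^t g_p`). Since `𝔖 ≠ 0`, every `β_p > 0`
(`singularProduct_eq_zero_of_localFactor_eq_zero`), i.e. `g_p ≥ 1` and no form vanishes identically mod `p`; then every
form has at most one root mod `p`, so `g_p ≥ p − t` (`le_goodCount_add_of_pos`) and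
`β_p ≥ (1 − t/p)(1 + 1/(p−1))^t ≥ (1 − t/p)(1 + t/p) = 1 − t²/p²` (`one_sub_le_localFactor`), while always `β_p ≥ 1/p`
(`inv_le_localFactor`) and `β_p ≤ (p/(p−1))^t ≤ 2^t`. Hence, with `P₀ = 4t²`:
* for `p ≤ P₀`: `1 + |β_p − 1| + t²/p² ≤ 2 + 2^t + t² ≤ (2 + 2^t + t²) P₀ · β_p`;
* for `p > P₀`: `u = t²/p² ≤ 1/4`, `β_p ≥ 1 − u ≥ 1/2` and `1 + |β_p − 1| + u ≤ β_p (1 + 6u)`;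
so `G_w ≤ ((2 + 2^t + t²) P₀)^{P₀+1} · exp(6t²/P₀) · ∏_{p ≤ w} β_p` (`gscale_le_mul_singularProductPartial`). Finally
`∏_{w < p ≤ x} β_p ≥ (1/P₀)^{P₀+1} · (1 − t²/P₀) ≥ ½ (1/P₀)^{P₀+1}` for every `x` (Weierstrass' product inequality,
tree `APSystem.prod_ge_one_sub_sum`), so letting `x → ∞` in `∏_{p ≤ x} β_p = ∏_{p ≤ w} β_p · ∏_{w<p≤x} β_p`
(Green–Tao Lemma 1.3, `tendsto_singularProductPartial_holds`) gives `∏_{p ≤ w} β_p ≤ 2 P₀^{P₀+1} 𝔖`.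
-/

noncomputable section

open scoped BigOperators Classical Topology
open Finset Filter Literature.NumberTheory.Sieve
open Summit.Parity.GeneralizedHardyLittlewood.Cruxes.RelativeDimOne.GallagherBackwardsSplit
open Summit.Parity.GeneralizedHardyLittlewood.Cruxes.CellParityLaw.SectionAnnihilator

namespace Summit.Parity.GeneralizedHardyLittlewood.Cruxes.RelativeDimOne.TypeSplit

variable {t : ℕ}

namespace SingularWeights

/-! ### Lower bounds for positive local factors of one-dimensional systems -/

/-- If `g_p > 0` (no form vanishes identically mod `p`) then every form `a v + b` has at most one root mod `p`, so
`p ≤ g_p + T`. -/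
theorem le_goodCount_add_of_pos {T p : ℕ} [Fact p.Prime] (Φ : Fin T → AffLinForm 1) (hg : 0 < goodCount Φ p) :
    p ≤ goodCount Φ p + T := by
  have hzero : ∀ k, #(univ.filter fun v : Fin 1 → ZMod p => (Φ k).modEval p v = 0) ≤ 1 := by
    intro k
    by_cases ha : (((Φ k).coeff 0 : ℤ) : ZMod p) = 0
    · by_cases hb : (((Φ k).const : ℤ) : ZMod p) = 0
      · exfalso
        have h0 : goodCount Φ p = 0 := by
          unfold goodCount
          rw [Finset.card_eq_zero, Finset.filter_eq_empty_iff]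
          intro v _ hv
          exact hv k (by rw [SingularRatio.modEval_one, ha, hb, zero_mul, zero_add])
        omega
      · have h0 : (univ.filter fun v : Fin 1 → ZMod p => (Φ k).modEval p v = 0) = ∅ := by
          rw [Finset.filter_eq_empty_iff]
          intro v _ hv
          rw [SingularRatio.modEval_one, ha, zero_mul, zero_add] at hv
          exact hb hv
        rw [h0, Finset.card_empty]
        exact Nat.zero_le _
    · exact (card_zeros_eq_one_of_coeff (Φ k) ha).le
  have hbad : #(univ.filter fun v : Fin 1 → ZMod p => ¬ ∀ k, ¬ (Φ k).modEval p v = 0) ≤ T := by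
    have h1 : (univ.filter fun v : Fin 1 → ZMod p => ¬ ∀ k, ¬ (Φ k).modEval p v = 0) =
        univ.biUnion fun k => univ.filter fun v : Fin 1 → ZMod p => (Φ k).modEval p v = 0 := by
      ext v
      simp
    rw [h1]
    refine Finset.card_biUnion_le.trans ?_
    calc ∑ k, #(univ.filter fun v : Fin 1 → ZMod p => (Φ k).modEval p v = 0) ≤ ∑ _k : Fin T, 1 :=
          Finset.sum_le_sum fun k _ => hzero k
      _ = T := by simp
  have htot := Finset.card_filter_add_card_filter_not (s := (univ : Finset (Fin 1 → ZMod p)))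
    (fun v => ∀ k, ¬ (Φ k).modEval p v = 0)
  rw [Finset.card_univ, card_zmod_pow, pow_one] at htot
  unfold goodCount at hg ⊢
  omega

/-- `𝔖(Φ) ≠ 0` (non-degenerate `Φ`) forces `β_p(Φ) > 0` at every prime. -/
theorem localFactor_pos_of_singularProduct_ne_zero {T : ℕ} {Φ : Fin T → AffLinForm 1} (hΦ : IsNondegenerateSystem Φ)
    (hS : singularProduct Φ ≠ 0) {p : ℕ} (hp : p.Prime) : 0 < localFactor Φ p :=
  lt_of_le_of_ne (localFactor_nonneg Φ p) fun h => hS (singularProduct_eq_zero_of_localFactor_eq_zero Φ hΦ hp h.symm)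

/-- A positive local factor is at least `1/p` (`g_p ≥ 1`, `(p/(p−1))^T ≥ 1`). -/
theorem inv_le_localFactor {T p : ℕ} (Φ : Fin T → AffLinForm 1) (hp : p.Prime) (hβ : 0 < localFactor Φ p) :
    (p : ℝ)⁻¹ ≤ localFactor Φ p := by
  haveI := Fact.mk hp
  have hg : 0 < goodCount Φ p := (goodCount_pos_iff_localFactor_pos Φ hp).mpr hβ
  have hg1 : (1 : ℝ) ≤ goodCount Φ p := by exact_mod_cast hg
  have hp2 : (2 : ℝ) ≤ p := by exact_mod_cast hp.two_le
  have hr1 : (1 : ℝ) ≤ (p : ℝ) / (p - 1) := by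
    rw [le_div_iff₀ (by linarith)]
    linarith
  rw [localFactor_prime, pow_one]
  calc (p : ℝ)⁻¹ = (p : ℝ)⁻¹ * (1 * 1) := by ring
    _ ≤ (p : ℝ)⁻¹ * (((p : ℝ) / (p - 1)) ^ T * goodCount Φ p) :=
        mul_le_mul_of_nonneg_left (mul_le_mul (one_le_pow₀ hr1) hg1 zero_le_one (by positivity)) (by positivity)

/-- A positive local factor is at least `1 − T²/p²`: `g_p ≥ p − T` and `(p/(p−1))^T ≥ 1 + T/p`, so
`β_p ≥ (1 − T/p)(1 + T/p)`. -/
theorem one_sub_le_localFactor {T p : ℕ} (Φ : Fin T → AffLinForm 1) (hp : p.Prime) (hβ : 0 < localFactor Φ p) :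
    1 - (T : ℝ) ^ 2 / (p : ℝ) ^ 2 ≤ localFactor Φ p := by
  haveI := Fact.mk hp
  have hp2 : (2 : ℝ) ≤ p := by exact_mod_cast hp.two_le
  have hp0 : (0 : ℝ) < p := by linarith
  rcases le_or_gt (p : ℝ) T with hpT | hpT
  · -- trivial: `1 − T²/p² ≤ 0 ≤ β_p`
    have : 1 ≤ (T : ℝ) ^ 2 / (p : ℝ) ^ 2 := by
      rw [le_div_iff₀ (by positivity)]
      nlinarith
    linarith [hβ.le]
  have hg : 0 < goodCount Φ p := (goodCount_pos_iff_localFactor_pos Φ hp).mpr hβ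
  have hgT : (p : ℝ) - T ≤ goodCount Φ p := by
    have h := le_goodCount_add_of_pos Φ hg
    have : ((p : ℕ) : ℝ) ≤ ((goodCount Φ p + T : ℕ) : ℝ) := by exact_mod_cast h
    push_cast at this
    linarith
  -- Bernoulli: `(p/(p-1))^T = (1 + 1/(p-1))^T ≥ 1 + T/(p-1) ≥ 1 + T/p`
  have hp1 : (0 : ℝ) < (p : ℝ) - 1 := by linarith
  have hbern : 1 + (T : ℝ) / p ≤ ((p : ℝ) / (p - 1)) ^ T := by
    have e : (p : ℝ) / (p - 1) = 1 + 1 / ((p : ℝ) - 1) := by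
      field_simp
      ring
    rw [e]
    calc 1 + (T : ℝ) / p ≤ 1 + (T : ℝ) * (1 / ((p : ℝ) - 1)) := by
          rw [mul_one_div]
          gcongr
          · linarith
      _ ≤ (1 + 1 / ((p : ℝ) - 1)) ^ T := one_add_mul_le_pow (by
          have : (0 : ℝ) ≤ 1 / ((p : ℝ) - 1) := by positivity
          linarith) T
  have ht0 : 0 ≤ 1 - (T : ℝ) / p := by
    rw [sub_nonneg, div_le_one hp0]
    exact hpT.le
  rw [localFactor_prime, pow_one]
  calc 1 - (T : ℝ) ^ 2 / (p : ℝ) ^ 2 = (1 - (T : ℝ) / p) * (1 + (T : ℝ) / p) := by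
        field_simp
        ring
    _ ≤ (1 - (T : ℝ) / p) * ((p : ℝ) / (p - 1)) ^ T := mul_le_mul_of_nonneg_left hbern ht0
    _ = (p : ℝ)⁻¹ * (((p : ℝ) / (p - 1)) ^ T * ((p : ℝ) - T)) := by
        field_simp
    _ ≤ (p : ℝ)⁻¹ * (((p : ℝ) / (p - 1)) ^ T * goodCount Φ p) := by
        gcongr

/-! ### The weight `1 + |β_p − 1| + t²/p²` against `β_p` -/

/-- SMALL PRIMES `p ≤ P`: `1 + |β_p − 1| + t²/p² ≤ (2 + 2^t + t²) P · β_p` (`0 ≤ β_p ≤ 2^t`, `β_p ≥ 1/p ≥ 1/P`). -/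
theorem one_add_wt_le_small (a b : Fin t → ℤ) {p P : ℕ} (hp : p.Prime) (hβ : 0 < localFactor (sys a b) p)
    (hpP : p ≤ P) : 1 + wt a b p ≤ (2 + 2 ^ t + (t : ℝ) ^ 2) * P * localFactor (sys a b) p := by
  have hp2 : (2 : ℝ) ≤ p := by exact_mod_cast hp.two_le
  have hp0 : (0 : ℝ) < p := by linarith
  have hP : (p : ℝ) ≤ P := by exact_mod_cast hpP
  have hβ1 : localFactor (sys a b) p ≤ 2 ^ t :=
    (localFactor_prime_le (sys a b) hp).trans (div_pred_pow_le_two_pow hp.two_le t)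
  have h2t : (1 : ℝ) ≤ 2 ^ t := one_le_pow₀ (by norm_num)
  have habs : |localFactor (sys a b) p - 1| ≤ 2 ^ t := by
    rw [abs_le]
    constructor <;> linarith
  have hu : (t : ℝ) ^ 2 / (p : ℝ) ^ 2 ≤ (t : ℝ) ^ 2 := div_le_self (by positivity) (by nlinarith)
  have hinv : 1 ≤ (P : ℝ) * localFactor (sys a b) p := by
    have h1 := inv_le_localFactor (sys a b) hp hβ
    calc (1 : ℝ) = (p : ℝ) * (p : ℝ)⁻¹ := by field_simp
      _ ≤ (P : ℝ) * localFactor (sys a b) p := mul_le_mul hP h1 (by positivity) (by positivity)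
  have hA : 1 + wt a b p ≤ 2 + 2 ^ t + (t : ℝ) ^ 2 := by
    unfold wt
    linarith
  have hA0 : (0 : ℝ) ≤ 2 + 2 ^ t + (t : ℝ) ^ 2 := by positivity
  calc 1 + wt a b p ≤ (2 + 2 ^ t + (t : ℝ) ^ 2) * 1 := by linarith
    _ ≤ (2 + 2 ^ t + (t : ℝ) ^ 2) * ((P : ℝ) * localFactor (sys a b) p) := mul_le_mul_of_nonneg_left hinv hA0
    _ = (2 + 2 ^ t + (t : ℝ) ^ 2) * P * localFactor (sys a b) p := by ring

/-- LARGE PRIMES `p ≥ 2t²` (and `β_p > 0`): with `u = t²/p² ≤ 1/2`, `β_p ≥ 1 − u ≥ 1/2` and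
`1 + |β_p − 1| + u ≤ β_p (1 + 6u)`. -/
theorem one_add_wt_le_large (a b : Fin t → ℤ) {p : ℕ} (hp : p.Prime) (hβ : 0 < localFactor (sys a b) p)
    (hpt : 2 * t ^ 2 ≤ p) : 1 + wt a b p ≤ (1 + 6 * ((t : ℝ) ^ 2 / (p : ℝ) ^ 2)) * localFactor (sys a b) p := by
  have hp2 : (2 : ℝ) ≤ p := by exact_mod_cast hp.two_le
  have hp0 : (0 : ℝ) < p := by linarith
  set u : ℝ := (t : ℝ) ^ 2 / (p : ℝ) ^ 2 with hu
  have hu0 : 0 ≤ u := by positivity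
  have hu2 : u ≤ 1 / 2 := by
    rw [hu, div_le_iff₀ (by positivity)]
    have h1 : 2 * (t : ℝ) ^ 2 ≤ p := by exact_mod_cast hpt
    nlinarith
  have hlow : 1 - u ≤ localFactor (sys a b) p := one_sub_le_localFactor (sys a b) hp hβ
  set β := localFactor (sys a b) p with hβdef
  have hβ2 : 1 / 2 ≤ β := by linarith
  show 1 + (|β - 1| + u) ≤ (1 + 6 * u) * β
  rcases le_or_gt 1 β with h1 | h1
  · rw [abs_of_nonneg (by linarith)]
    nlinarith
  · rw [abs_of_neg (by linarith)]
    nlinarith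

/-! ### `G_w ≤ C₁ ∏_{p ≤ w} β_p` -/

/-- The per-prime ratio: `(2 + 2^t + t²) P₀` at `p ≤ P₀`, `1 + 6t²/p²` beyond. -/
theorem one_add_wt_le_ratio (a b : Fin t → ℤ) {p : ℕ} (hp : p.Prime) (hβ : 0 < localFactor (sys a b) p) :
    1 + wt a b p ≤ (if p ≤ 4 * t ^ 2 then (2 + 2 ^ t + (t : ℝ) ^ 2) * ((4 * t ^ 2 : ℕ) : ℝ)
        else 1 + 6 * ((t : ℝ) ^ 2 / (p : ℝ) ^ 2)) * localFactor (sys a b) p := by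
  split_ifs with h
  · exact one_add_wt_le_small a b hp hβ h
  · exact one_add_wt_le_large a b hp hβ (by omega)

/-- **`G_w(a,b) ≤ C₁(t) ∏_{p ≤ w} β_p(a,b)`** with `C₁ = ((2 + 2^t + t²) P₀)^{P₀+1} exp(6t²/P₀)`, `P₀ = 4t²`, whenever all
`β_p > 0`. -/
theorem gscale_le_mul_singularProductPartial (ht : 1 ≤ t) (a b : Fin t → ℤ)
    (hβ : ∀ p : ℕ, p.Prime → 0 < localFactor (sys a b) p) (w : ℕ) :
    gscale w a b ≤ ((2 + 2 ^ t + (t : ℝ) ^ 2) * ((4 * t ^ 2 : ℕ) : ℝ)) ^ (4 * t ^ 2 + 1) *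
      Real.exp (6 * (t : ℝ) ^ 2 / ((4 * t ^ 2 : ℕ) : ℝ)) * singularProductPartial (sys a b) w := by
  set P₀ : ℕ := 4 * t ^ 2 with hP₀
  set A : ℝ := (2 + 2 ^ t + (t : ℝ) ^ 2) * (P₀ : ℝ) with hA
  set ratio : ℕ → ℝ := fun p => if p ≤ P₀ then A else 1 + 6 * ((t : ℝ) ^ 2 / (p : ℝ) ^ 2) with hratio
  have hP₀1 : 1 ≤ P₀ := by
    rw [hP₀]
    nlinarith
  have hA1 : 1 ≤ A := by
    have h1 : (1 : ℝ) ≤ P₀ := by exact_mod_cast hP₀1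
    have h2 : (1 : ℝ) ≤ 2 + 2 ^ t + (t : ℝ) ^ 2 := by
      have : (0 : ℝ) ≤ 2 ^ t + (t : ℝ) ^ 2 := by positivity
      linarith
    rw [hA]
    nlinarith
  -- factorwise
  have hfac : gscale w a b ≤ (∏ p ∈ Nat.primesLE w, ratio p) * singularProductPartial (sys a b) w := by
    unfold gscale singularProductPartial
    rw [← Finset.prod_mul_distrib]
    refine Finset.prod_le_prod (fun p _ => ?_) fun p hp => ?_
    · unfold wt
      positivity
    · have hpp := Nat.prime_of_mem_primesLE hp
      exact one_add_wt_le_ratio a b hpp (hβ p hpp)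
  -- the ratio product
  have hsmall : ∏ p ∈ (Nat.primesLE w).filter (fun p => p ≤ P₀), A ≤ A ^ (P₀ + 1) := by
    rw [Finset.prod_const]
    refine pow_le_pow_right₀ hA1 ?_
    calc #((Nat.primesLE w).filter (fun p => p ≤ P₀)) ≤ #(Finset.range (P₀ + 1)) :=
          Finset.card_le_card fun p hp => Finset.mem_range.mpr (Nat.lt_succ_of_le (Finset.mem_filter.mp hp).2)
      _ = P₀ + 1 := Finset.card_range _
  have hlarge : ∏ p ∈ (Nat.primesLE w).filter (fun p => ¬ p ≤ P₀), (1 + 6 * ((t : ℝ) ^ 2 / (p : ℝ) ^ 2)) ≤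
      Real.exp (6 * (t : ℝ) ^ 2 / P₀) := by
    calc ∏ p ∈ (Nat.primesLE w).filter (fun p => ¬ p ≤ P₀), (1 + 6 * ((t : ℝ) ^ 2 / (p : ℝ) ^ 2))
        ≤ Real.exp (∑ p ∈ (Nat.primesLE w).filter (fun p => ¬ p ≤ P₀), 6 * ((t : ℝ) ^ 2 / (p : ℝ) ^ 2)) := by
          rw [Real.exp_sum]
          refine Finset.prod_le_prod (fun p _ => by positivity) fun p _ => ?_
          linarith [Real.add_one_le_exp (6 * ((t : ℝ) ^ 2 / (p : ℝ) ^ 2))]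
      _ ≤ Real.exp (6 * (t : ℝ) ^ 2 / P₀) := by
          refine Real.exp_le_exp.mpr ?_
          calc ∑ p ∈ (Nat.primesLE w).filter (fun p => ¬ p ≤ P₀), 6 * ((t : ℝ) ^ 2 / (p : ℝ) ^ 2)
              ≤ ∑ n ∈ Finset.Ioc P₀ w, 6 * ((t : ℝ) ^ 2 / (n : ℝ) ^ 2) := by
                refine Finset.sum_le_sum_of_subset_of_nonneg (fun p hp => ?_) (fun n _ _ => by positivity)
                rw [Finset.mem_filter, Nat.mem_primesLE] at hp
                exact Finset.mem_Ioc.mpr ⟨by omega, hp.1.1⟩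
            _ = 6 * (t : ℝ) ^ 2 * ∑ n ∈ Finset.Ioc P₀ w, ((n : ℝ) ^ 2)⁻¹ := by
                rw [Finset.mul_sum]
                exact Finset.sum_congr rfl fun n _ => by rw [div_eq_mul_inv]; ring
            _ ≤ 6 * (t : ℝ) ^ 2 * (P₀ : ℝ)⁻¹ := by
                gcongr
                exact sum_Ioc_inv_sq_le hP₀1 w
            _ = 6 * (t : ℝ) ^ 2 / P₀ := by rw [div_eq_mul_inv]
  have hprod : ∏ p ∈ Nat.primesLE w, ratio p ≤ A ^ (P₀ + 1) * Real.exp (6 * (t : ℝ) ^ 2 / P₀) := by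
    rw [← Finset.prod_filter_mul_prod_filter_not (Nat.primesLE w) (fun p => p ≤ P₀)]
    have e1 : ∏ p ∈ (Nat.primesLE w).filter (fun p => p ≤ P₀), ratio p =
        ∏ p ∈ (Nat.primesLE w).filter (fun p => p ≤ P₀), A :=
      Finset.prod_congr rfl fun p hp => by rw [hratio]; exact if_pos (Finset.mem_filter.mp hp).2
    have e2 : ∏ p ∈ (Nat.primesLE w).filter (fun p => ¬ p ≤ P₀), ratio p =
        ∏ p ∈ (Nat.primesLE w).filter (fun p => ¬ p ≤ P₀), (1 + 6 * ((t : ℝ) ^ 2 / (p : ℝ) ^ 2)) :=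
      Finset.prod_congr rfl fun p hp => by rw [hratio]; exact if_neg (Finset.mem_filter.mp hp).2
    rw [e1, e2]
    have h0 : 0 ≤ ∏ p ∈ (Nat.primesLE w).filter (fun p => ¬ p ≤ P₀), (1 + 6 * ((t : ℝ) ^ 2 / (p : ℝ) ^ 2)) :=
      Finset.prod_nonneg fun p _ => by positivity
    exact mul_le_mul hsmall hlarge h0 (by positivity)
  have hS0 : 0 ≤ singularProductPartial (sys a b) w := SingularRatio.singularProductPartial_nonneg _ _
  calc gscale w a b ≤ (∏ p ∈ Nat.primesLE w, ratio p) * singularProductPartial (sys a b) w := hfac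
    _ ≤ A ^ (P₀ + 1) * Real.exp (6 * (t : ℝ) ^ 2 / P₀) * singularProductPartial (sys a b) w :=
        mul_le_mul_of_nonneg_right hprod hS0

/-! ### `∏_{p ≤ w} β_p ≤ C₂ 𝔖` -/

/-- TAIL PRODUCTS ARE BOUNDED BELOW uniformly: `∏_{w < p ≤ x} β_p ≥ ½ (1/P₀)^{P₀+1}`, `P₀ = 4t²`, whenever all
`β_p > 0` (`β_p ≥ 1/P₀` at the `≤ P₀ + 1` primes `p ≤ P₀`; `∏ (1 − t²/p²) ≥ 1 − t²/P₀ ≥ ½` beyond). -/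
theorem prod_tail_localFactor_ge (ht : 1 ≤ t) (a b : Fin t → ℤ) (hβ : ∀ p : ℕ, p.Prime → 0 < localFactor (sys a b) p)
    (w x : ℕ) :
    1 / 2 * ((4 * t ^ 2 : ℕ) : ℝ)⁻¹ ^ (4 * t ^ 2 + 1) ≤ ∏ p ∈ Nat.primesLE x \ Nat.primesLE w, localFactor (sys a b) p := by
  set P₀ : ℕ := 4 * t ^ 2 with hP₀
  set S := Nat.primesLE x \ Nat.primesLE w with hS
  have hP₀1 : 1 ≤ P₀ := by
    rw [hP₀]
    nlinarith
  have hP₀r : (1 : ℝ) ≤ P₀ := by exact_mod_cast hP₀1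
  have hmem : ∀ p ∈ S, p.Prime ∧ w < p ∧ p ≤ x := by
    intro p hp
    obtain ⟨hp1, hp2⟩ := Finset.mem_sdiff.mp hp
    rw [Nat.mem_primesLE] at hp1 hp2
    exact ⟨hp1.2, by by_contra hh; exact hp2 ⟨by omega, hp1.2⟩, hp1.1⟩
  -- small primes of the tail
  have h1 : (P₀ : ℝ)⁻¹ ^ (P₀ + 1) ≤ ∏ p ∈ S.filter (fun p => p ≤ P₀), localFactor (sys a b) p := by
    calc (P₀ : ℝ)⁻¹ ^ (P₀ + 1) ≤ (P₀ : ℝ)⁻¹ ^ #(S.filter (fun p => p ≤ P₀)) := by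
          refine pow_le_pow_of_le_one (by positivity) (inv_le_one_of_one_le₀ hP₀r) ?_
          calc #(S.filter (fun p => p ≤ P₀)) ≤ #(Finset.range (P₀ + 1)) :=
                Finset.card_le_card fun p hp => Finset.mem_range.mpr (Nat.lt_succ_of_le (Finset.mem_filter.mp hp).2)
            _ = P₀ + 1 := Finset.card_range _
      _ = ∏ p ∈ S.filter (fun p => p ≤ P₀), (P₀ : ℝ)⁻¹ := (Finset.prod_const _).symm
      _ ≤ ∏ p ∈ S.filter (fun p => p ≤ P₀), localFactor (sys a b) p := by
          refine Finset.prod_le_prod (fun p _ => by positivity) fun p hp => ?_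
          obtain ⟨hpS, hpP⟩ := Finset.mem_filter.mp hp
          have hpp := (hmem p hpS).1
          calc (P₀ : ℝ)⁻¹ ≤ (p : ℝ)⁻¹ := by
                refine inv_anti₀ (by exact_mod_cast hpp.pos) (by exact_mod_cast hpP)
            _ ≤ localFactor (sys a b) p := inv_le_localFactor (sys a b) hpp (hβ p hpp)
  -- large primes of the tail
  have h2 : (1 : ℝ) / 2 ≤ ∏ p ∈ S.filter (fun p => ¬ p ≤ P₀), localFactor (sys a b) p := by
    have hlow := Literature.Barriers.Parity.APSystem.prod_ge_one_sub_sum (S.filter (fun p => ¬ p ≤ P₀))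
      (fun p => localFactor (sys a b) p) (fun p => (t : ℝ) ^ 2 / (p : ℝ) ^ 2)
      (fun p _ => localFactor_nonneg _ p) (fun p _ => by positivity)
      (fun p hp => one_sub_le_localFactor (sys a b) (hmem p (Finset.mem_filter.mp hp).1).1
        (hβ p (hmem p (Finset.mem_filter.mp hp).1).1))
    refine le_trans ?_ hlow
    have hsum : ∑ p ∈ S.filter (fun p => ¬ p ≤ P₀), (t : ℝ) ^ 2 / (p : ℝ) ^ 2 ≤ 1 / 2 := by
      calc ∑ p ∈ S.filter (fun p => ¬ p ≤ P₀), (t : ℝ) ^ 2 / (p : ℝ) ^ 2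
          ≤ ∑ n ∈ Finset.Ioc P₀ x, (t : ℝ) ^ 2 / (n : ℝ) ^ 2 := by
            refine Finset.sum_le_sum_of_subset_of_nonneg (fun p hp => ?_) (fun n _ _ => by positivity)
            obtain ⟨hpS, hpP⟩ := Finset.mem_filter.mp hp
            exact Finset.mem_Ioc.mpr ⟨by omega, (hmem p hpS).2.2⟩
        _ = (t : ℝ) ^ 2 * ∑ n ∈ Finset.Ioc P₀ x, ((n : ℝ) ^ 2)⁻¹ := by
            rw [Finset.mul_sum]
            exact Finset.sum_congr rfl fun n _ => by rw [div_eq_mul_inv]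
        _ ≤ (t : ℝ) ^ 2 * (P₀ : ℝ)⁻¹ := by
            gcongr
            exact sum_Ioc_inv_sq_le hP₀1 x
        _ ≤ 1 / 2 := by
            have hP : (P₀ : ℝ) = 4 * (t : ℝ) ^ 2 := by rw [hP₀]; push_cast; ring
            rw [hP, ← div_eq_mul_inv, div_le_iff₀ (by positivity)]
            nlinarith [sq_nonneg (t : ℝ)]
    linarith
  rw [← Finset.prod_filter_mul_prod_filter_not S (fun p => p ≤ P₀)]
  calc 1 / 2 * (P₀ : ℝ)⁻¹ ^ (P₀ + 1) = (P₀ : ℝ)⁻¹ ^ (P₀ + 1) * (1 / 2) := by ring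
    _ ≤ (∏ p ∈ S.filter (fun p => p ≤ P₀), localFactor (sys a b) p) *
          ∏ p ∈ S.filter (fun p => ¬ p ≤ P₀), localFactor (sys a b) p :=
        mul_le_mul h1 h2 (by norm_num) (Finset.prod_nonneg fun p _ => localFactor_nonneg _ p)

/-- **`∏_{p ≤ w} β_p ≤ 2 P₀^{P₀+1} 𝔖`** for a non-degenerate system all of whose local factors are positive: pass to
the limit `x → ∞` in `∏_{p ≤ x} β_p = ∏_{p ≤ w} β_p · ∏_{w < p ≤ x} β_p ≥ c₀ ∏_{p ≤ w} β_p`. -/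
theorem singularProductPartial_le_mul_singularProduct (ht : 1 ≤ t) (a b : Fin t → ℤ)
    (hΨ : IsNondegenerateSystem (sys a b)) (hβ : ∀ p : ℕ, p.Prime → 0 < localFactor (sys a b) p) (w : ℕ) :
    singularProductPartial (sys a b) w ≤
      (1 / 2 * ((4 * t ^ 2 : ℕ) : ℝ)⁻¹ ^ (4 * t ^ 2 + 1))⁻¹ * singularProduct (sys a b) := by
  set c₀ : ℝ := 1 / 2 * ((4 * t ^ 2 : ℕ) : ℝ)⁻¹ ^ (4 * t ^ 2 + 1) with hc₀
  have hc₀pos : 0 < c₀ := by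
    have : (0 : ℝ) < ((4 * t ^ 2 : ℕ) : ℝ) := by
      have h1 : 1 ≤ 4 * t ^ 2 := by nlinarith
      exact_mod_cast h1
    positivity
  have hT := tendsto_singularProductPartial_holds 1 t (sys a b) hΨ
  have hhead0 : 0 ≤ singularProductPartial (sys a b) w := SingularRatio.singularProductPartial_nonneg _ _
  have hev : ∀ᶠ x in atTop, singularProductPartial (sys a b) w * c₀ ≤ singularProductPartial (sys a b) x := by
    refine Filter.eventually_atTop.mpr ⟨w, fun x hwx => ?_⟩
    have hsplit : singularProductPartial (sys a b) x =
        singularProductPartial (sys a b) w * ∏ p ∈ Nat.primesLE x \ Nat.primesLE w, localFactor (sys a b) p := by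
      unfold singularProductPartial
      rw [mul_comm, Finset.prod_sdiff (Nat.primesLE_mono hwx)]
    rw [hsplit]
    exact mul_le_mul_of_nonneg_left (prod_tail_localFactor_ge ht a b hβ w x) hhead0
  have hlim := ge_of_tendsto hT hev
  rw [← div_eq_inv_mul, le_div_iff₀ hc₀pos]
  exact hlim

end SingularWeights

open SingularWeights in
/-- **(W1) THE SMOOTH SCALE IS DOMINATED BY THE SINGULAR SERIES** (registered hook, first conjunct of
`SingularWeightFacts`): for `t ≥ 1` there is `C_t > 0` with `G_w(a,b) ≤ C_t 𝔖(a,b)` for all `w` and all non-degenerate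
`(a, b)` with `𝔖(a, b) ≠ 0` (`C_t = C₁(t) · 2 P₀^{P₀+1}`, `P₀ = 4t²`; no size bound on `a` is needed). -/
theorem singularWeights_W1 : ∀ t : ℕ, 1 ≤ t → ∃ Cw : ℝ, 0 < Cw ∧ ∀ (w : ℕ) (a b : Fin t → ℤ), IsNondegenerateSystem (sys a b) → singularProduct (sys a b) ≠ 0 → gscale w a b ≤ Cw * singularProduct (sys a b) := by
  intro t ht
  set C₁ : ℝ := ((2 + 2 ^ t + (t : ℝ) ^ 2) * ((4 * t ^ 2 : ℕ) : ℝ)) ^ (4 * t ^ 2 + 1) *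
      Real.exp (6 * (t : ℝ) ^ 2 / ((4 * t ^ 2 : ℕ) : ℝ)) with hC₁
  set c₀ : ℝ := 1 / 2 * ((4 * t ^ 2 : ℕ) : ℝ)⁻¹ ^ (4 * t ^ 2 + 1) with hc₀
  have hP : (0 : ℝ) < ((4 * t ^ 2 : ℕ) : ℝ) := by
    have h1 : 1 ≤ 4 * t ^ 2 := by nlinarith
    exact_mod_cast h1
  have hC₁pos : 0 < C₁ := by positivity
  have hc₀pos : 0 < c₀ := by positivity
  refine ⟨C₁ * c₀⁻¹, by positivity, fun w a b hΨ hS => ?_⟩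
  have hβ : ∀ p : ℕ, p.Prime → 0 < localFactor (sys a b) p := fun p hp =>
    localFactor_pos_of_singularProduct_ne_zero hΨ hS hp
  have h1 := gscale_le_mul_singularProductPartial ht a b hβ w
  have h2 := singularProductPartial_le_mul_singularProduct ht a b hΨ hβ w
  calc gscale w a b ≤ C₁ * singularProductPartial (sys a b) w := h1
    _ ≤ C₁ * (c₀⁻¹ * singularProduct (sys a b)) := mul_le_mul_of_nonneg_left h2 hC₁pos.le
    _ = C₁ * c₀⁻¹ * singularProduct (sys a b) := by ring

end Summit.Parity.GeneralizedHardyLittlewood.Cruxes.RelativeDimOne.TypeSplit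

end
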